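import Summits.CriticalPhenomena.PercolationContinuityZ3.Theorems.PercNearOneGluingNoHeavyQuantLawDecFlowsDecomposition
import Summits.CriticalPhenomena.PercolationContinuityZ3.Theorems.PercNearOneGluingNoHeavyQuantGatedConvSplit
import Summits.CriticalPhenomena.PercolationContinuityZ3.Theorems.PercNearOneGluingNoHeavyQuantGatedShiftRates
import HarnessLib

/-!
# QUANT lane R8, Route 1 (`SingleGateConvClosed`): MEMBERS of a cellwise certificate — price systems of the gated factors at ANY layer
# are row / column certificates; the typed certificate-to-DEC theorem on the SUPPORT of the factors; two standard members
# (two-layer rows, high-row pullbacks) are valid price systems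

builds on p205010 (kernel theorem, internal audit signed; external expert review pending)

Support file (`--supports stmt-CriticalPhenomena-4575`), QUANT lane seat prim-quant-arm-2 (gen 42), rung R8 of
`run/shared/lean/prim/quant/LADDER.md`; memos `run/shared/lean/prim/quant/prim-quant-arm-2-g41/MATRIX-SGC-G41.md` (§5b, §7 (b)) and
`run/shared/lean/prim/quant/prim-quant-arm-2-g42/CERT-MEMBERS-G42.md`.  Pure theorems (the price vector is a local notation); standard axioms, no sorries, no definitions.  Continues arm-2 g41's `…QuantSGCCellCertificate` (the cellwise-certificate
principle `sum_test_nonpos_of_cellCert` / `flowAtT_gate_lconv_of_cellCert`, which takes the row and column certificates `R`, `C` as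
ARBITRARY functions with `Σ_i μ₁ i·R k i ≤ 0`, `Σ_k μ₂ k·C i k ≤ 0`).

WHY.  Every certificate the lane's censuses produce for the dual route to `LawDec.SingleGateConvClosed` (memo MATRIX-SGC-G41 §5: the
family F** — two-layer rows of the factors at all layers, prefix-economical pullbacks, mean tilts; 0 exact failures on 573 adversarial price
systems; arm-2 g42: law-dependent certificates on the support with each line's members at its natural layer AND ABOVE) is a nonnegative
combination of PRICE SYSTEMS of the gated factors `ν₁ = gate μ₁ q`, `ν₂ = gate μ₂ q` at various layers.  This file proves once:
(1) a price system `(α, β)` of the structure `(x, T, L, M)` tested against a law that is DEC there is nonpositive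
(`sum_priceVec_gate_nonpos`, weak duality `dual_le_of_decAtT` rewritten as ONE sum of the price vector); (2) hence, per unit of
`μ₁`-mass, `i ↦ θ·(q·v i + (1−q)·v 0)` is a row certificate (`sum_mu_mul_member_nonpos`; the `(1−q)·v 0` is the gate zero's phantom
share), and finite sums over layers stay row certificates (`sum_mu_mul_members_nonpos`); (3) the typed certificate theorem `decAt_gate_lconv_of_members` (weights `θ ≥ 0` on such members +
tilts dominating the product price cell by cell ON THE CHARGED CELLS ⟹ `gate_q(μ₁ ∗ μ₂)` DEC at that layer) is the companion file
`…QuantSGCCellMembersDEC` (it needs g41's `…QuantSGCCellCertificate`, whose olean the farm has not built yet); (4) `decAt_gate_allLayers`: the SGC hypotheses (DEC below the top, top-affordability) give DEC of `gate μ q` at EVERY layer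
(Theorem A above the top), so members at layers `≥ Mᵢ` are available too; (5) two member families ARE price systems: the TWO-LAYER ROW
charging a prefix of lows incompatible with every mid (`twoLayer_valid`), and the PULLBACK of a product price system to a HIGH row `s`
(`2s ≥ τ₂`) at its natural layer `j − s` (`pullback_valid`, rates by typer g26's `usage_shift_le` — arm-2 g37's H/V transport in dual form).

* `LawDec.PV[T, L, α, β, h`] = `α h` if `h ≤ L ∧ 2h < T` (a low of the structure), else `−β h`.
* `LawDec.sum_priceVec_nonpos`, `LawDec.sum_priceVec_gate_nonpos` — weak duality as one sum; for a gated law, per unit of `μ`-mass.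
* `LawDec.sum_mu_mul_member_nonpos`, `LawDec.sum_mu_mul_members_nonpos` — one member / a finite family of members is a line certificate.
* `LawDec.decAt_gate_allLayers` — DEC of `gate μ q` at every layer from SGC's hypotheses on one factor.
* (companion `…QuantSGCCellMembersDEC`: `LawDec.decAt_gate_lconv_of_members` — the typed F**-style certificate ⟹ DEC of the gated product.)
* `LawDec.twoLayer_valid`, `LawDec.pullback_valid` — two standard members are valid price systems.

[this work]; cellwise principle: prim-quant-arm-2 g41; weak/strong duality: prim-quant-stmt g22, prim-quant-census-2 g54; `usage_shift_le`:
prim-quant-stmt g26; two-layer rows: prim-quant-lead g37 (this lane).  LP duality [cite: Schrijver1986, Cor 7.1f (p. 90)].  The gluing rows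
served [cite: KozmaNitzan2024, Conjecture 3 (p. 15)]; product measure [cite: Grimmett1999, §1.3 p. 10].
-/

noncomputable section

namespace Summit.CriticalPhenomena.PercolationContinuityZ3.Theorems

namespace Quant

open Finset

namespace LawDec

/-! ### Price vectors and weak duality as one sum -/

/-- the PRICE VECTOR of a price system `(α, β)` of the structure (target `T`, layer `L`): `α` on the lows (`h ≤ L`, `2h < T`),
`−β` on every other atom (local notation, as the lane's `TP[…]`). -/
local notation3 "PV[" T ", " L ", " α ", " β ", " h "]" =>
  (if (h : ℕ) ≤ (L : ℕ) ∧ 2 * ((h : ℕ) : ℝ) < (T : ℝ) then (α : ℕ → ℝ) h else -(β : ℕ → ℝ) h)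

/-- the low part of the price functional, written over `range (L+1)` or over `range (M+1)`, is the same sum once the law vanishes above `M`.
[this work] -/
theorem sum_low_range_eq (T : ℝ) (L M : ℕ) (α ν : ℕ → ℝ) (hνM : ∀ h, M < h → ν h = 0) :
    ∑ l ∈ Finset.range (L + 1), (if 2 * (l : ℝ) < T then α l * ν l else 0)
      = ∑ h ∈ Finset.range (M + 1), (if h ≤ L ∧ 2 * (h : ℝ) < T then α h * ν h else 0) := by
  have hL : ∑ l ∈ Finset.range (L + 1), (if 2 * (l : ℝ) < T then α l * ν l else 0)
      = ∑ h ∈ Finset.range (L + M + 1), (if h ≤ L ∧ 2 * (h : ℝ) < T then α h * ν h else 0) := by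
    rw [← Finset.sum_subset (Finset.range_subset_range.2 (by omega : L + 1 ≤ L + M + 1)) (fun h _ hh => by
      have hL : ¬ h ≤ L := fun hc => hh (Finset.mem_range.2 (Nat.lt_succ_of_le hc))
      rw [if_neg (fun hc => hL hc.1)])]
    refine Finset.sum_congr rfl fun h hh => ?_
    have hle : h ≤ L := Nat.le_of_lt_succ (Finset.mem_range.1 hh)
    by_cases hlt : 2 * (h : ℝ) < T
    · rw [if_pos hlt, if_pos ⟨hle, hlt⟩]
    · rw [if_neg hlt, if_neg (fun hc => hlt hc.2)]
  have hM : ∑ h ∈ Finset.range (M + 1), (if h ≤ L ∧ 2 * (h : ℝ) < T then α h * ν h else 0)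
      = ∑ h ∈ Finset.range (L + M + 1), (if h ≤ L ∧ 2 * (h : ℝ) < T then α h * ν h else 0) := by
    rw [← Finset.sum_subset (Finset.range_subset_range.2 (by omega : M + 1 ≤ L + M + 1)) (fun h _ hh => by
      have hM : M < h := not_le.1 fun hc => hh (Finset.mem_range.2 (Nat.lt_succ_of_le hc))
      rw [hνM h hM, mul_zero, ite_self])]
  rw [hL, hM]

/-- **WEAK DUALITY AS ONE SUM**: if `ν` (vanishing above `M`) is DEC at `(x, T, L)` then every price system `(α, β)` of that structure
(`β ≥ 0`; `α l ≤ usage·β h` on compatible pairs) has `Σ_{h ≤ M} PV[h, ·, ν, h, ≤] 0`. [this work] -/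
theorem sum_priceVec_nonpos (x T : ℝ) (L M : ℕ) (ν : ℕ → ℝ) (hx0 : 0 < x) (hx1 : x < 1)
    (hνM : ∀ h, M < h → ν h = 0) (hD : DECAtT x T L M ν) (α β : ℕ → ℝ) (hβ : ∀ h, 0 ≤ β h)
    (hαβ : ∀ l h, l ≤ L → 2 * (l : ℝ) < T → h ≤ M → (L + 1 ≤ h ∨ T < (l : ℝ) + h) → α l ≤ usage x T L l h * β h) :
    ∑ h ∈ Finset.range (M + 1), PV[T, L, α, β, h] * ν h ≤ 0 := by
  have hdual := dual_le_of_decAtT x T L M ν hx0 hx1 hD α β hβ hαβ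
  rw [sum_low_range_eq T L M α ν hνM] at hdual
  have hsplit : ∑ h ∈ Finset.range (M + 1), PV[T, L, α, β, h] * ν h
      = ∑ h ∈ Finset.range (M + 1), (if h ≤ L ∧ 2 * (h : ℝ) < T then α h * ν h else 0)
        - ∑ h ∈ Finset.range (M + 1), (if h ≤ L ∧ 2 * (h : ℝ) < T then 0 else β h * ν h) := by
    rw [← Finset.sum_sub_distrib]
    refine Finset.sum_congr rfl fun h _ => ?_
    split_ifs <;> ring
  rw [hsplit]
  linarith

/-- **for a GATED law, per unit of `μ`-mass**: if `gate μ q` is DEC at `(x, T, L)` (`μ` a law of mass `1` on `{0..M}`), then for every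
price system `Σ_{i ≤ M} μ i · (q·v i + (1−q)·v 0) ≤ 0`, `v` the price vector (the `(1−q)·v 0` is the gate zero's phantom share).
[this work] -/
theorem sum_priceVec_gate_nonpos (x T q : ℝ) (L M : ℕ) (μ : ℕ → ℝ) (hx0 : 0 < x) (hx1 : x < 1)
    (hμM : ∀ h, M < h → μ h = 0) (hμ1 : ∑ h ∈ Finset.range (M + 1), μ h = 1)
    (hD : DECAtT x T L M (gate μ q)) (α β : ℕ → ℝ) (hβ : ∀ h, 0 ≤ β h)
    (hαβ : ∀ l h, l ≤ L → 2 * (l : ℝ) < T → h ≤ M → (L + 1 ≤ h ∨ T < (l : ℝ) + h) → α l ≤ usage x T L l h * β h) :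
    ∑ i ∈ Finset.range (M + 1), μ i * (q * PV[T, L, α, β, i] + (1 - q) * PV[T, L, α, β, 0]) ≤ 0 := by
  have hνM : ∀ h, M < h → gate μ q h = 0 := by
    intro h hh
    rw [gate_apply, hμM h hh, if_neg (by omega)]; ring
  have key := sum_priceVec_nonpos x T L M (gate μ q) hx0 hx1 hνM hD α β hβ hαβ
  -- `Σ f·gate μ q = q·Σ f·μ + (1−q)·f 0` for any test function `f`
  have hg : ∀ f : ℕ → ℝ, ∑ h ∈ Finset.range (M + 1), f h * gate μ q h
      = q * ∑ h ∈ Finset.range (M + 1), f h * μ h + (1 - q) * f 0 := by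
    intro f
    have e : ∀ h : ℕ, f h * gate μ q h = q * (f h * μ h) + (if h = 0 then (1 - q) * f 0 else 0) := by
      intro h
      rw [gate_apply]
      split_ifs with h0
      · rw [h0]; ring
      · ring
    simp_rw [e]
    rw [Finset.sum_add_distrib, ← Finset.mul_sum, Finset.sum_ite_eq' (Finset.range (M + 1)) 0,
      if_pos (Finset.mem_range.2 (Nat.succ_pos M))]
  rw [hg (fun h => PV[T, L, α, β, h])] at key
  have e : ∑ i ∈ Finset.range (M + 1), μ i * (q * PV[T, L, α, β, i] + (1 - q) * PV[T, L, α, β, 0])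
      = q * ∑ i ∈ Finset.range (M + 1), PV[T, L, α, β, i] * μ i
        + (1 - q) * PV[T, L, α, β, 0] * ∑ i ∈ Finset.range (M + 1), μ i := by
    rw [Finset.mul_sum, Finset.mul_sum, ← Finset.sum_add_distrib]
    refine Finset.sum_congr rfl fun i _ => ?_; ring
  rw [e, hμ1, mul_one]
  exact key

/-! ### Members and families of members are line certificates -/

/-- **ONE MEMBER**: a price system of `gate μ q` at a layer where it is DEC, scaled by `θ ≥ 0`, is a line certificate. [this work] -/
theorem sum_mu_mul_member_nonpos (x T q θ : ℝ) (L M : ℕ) (μ : ℕ → ℝ) (hx0 : 0 < x) (hx1 : x < 1) (hθ : 0 ≤ θ)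
    (hμM : ∀ h, M < h → μ h = 0) (hμ1 : ∑ h ∈ Finset.range (M + 1), μ h = 1)
    (hD : DECAtT x T L M (gate μ q)) (α β : ℕ → ℝ) (hβ : ∀ h, 0 ≤ β h)
    (hαβ : ∀ l h, l ≤ L → 2 * (l : ℝ) < T → h ≤ M → (L + 1 ≤ h ∨ T < (l : ℝ) + h) → α l ≤ usage x T L l h * β h) :
    ∑ i ∈ Finset.range (M + 1), μ i * (θ * (q * PV[T, L, α, β, i] + (1 - q) * PV[T, L, α, β, 0])) ≤ 0 := by
  have e : ∑ i ∈ Finset.range (M + 1), μ i * (θ * (q * PV[T, L, α, β, i] + (1 - q) * PV[T, L, α, β, 0]))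
      = θ * ∑ i ∈ Finset.range (M + 1), μ i * (q * PV[T, L, α, β, i] + (1 - q) * PV[T, L, α, β, 0]) := by
    rw [Finset.mul_sum]
    refine Finset.sum_congr rfl fun i _ => ?_; ring
  rw [e]
  exact mul_nonpos_of_nonneg_of_nonpos hθ (sum_priceVec_gate_nonpos x T q L M μ hx0 hx1 hμM hμ1 hD α β hβ hαβ)

/-- **A FINITE FAMILY OF MEMBERS** (one price system `(α L, β L)` with weight `θ L ≥ 0` per layer `L < N`; `gate μ q` DEC at every layer
`L < N` at target `T`) is a line certificate. [this work] -/
theorem sum_mu_mul_members_nonpos (x T q : ℝ) (N M : ℕ) (μ : ℕ → ℝ) (θ : ℕ → ℝ) (α β : ℕ → ℕ → ℝ)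
    (hx0 : 0 < x) (hx1 : x < 1) (hθ : ∀ L, 0 ≤ θ L)
    (hμM : ∀ h, M < h → μ h = 0) (hμ1 : ∑ h ∈ Finset.range (M + 1), μ h = 1)
    (hD : ∀ L, L < N → DECAtT x T L M (gate μ q)) (hβ : ∀ L h, 0 ≤ β L h)
    (hαβ : ∀ L l h : ℕ, l ≤ L → 2 * (l : ℝ) < T → h ≤ M → (L + 1 ≤ h ∨ T < (l : ℝ) + h) → α L l ≤ usage x T L l h * β L h) :
    ∑ i ∈ Finset.range (M + 1), μ i *
      (∑ L ∈ Finset.range N, θ L * (q * PV[T, L, (α L), (β L), i] + (1 - q) * PV[T, L, (α L), (β L), 0])) ≤ 0 := by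
  simp_rw [Finset.mul_sum]
  rw [Finset.sum_comm]
  exact Finset.sum_nonpos fun L hL =>
    sum_mu_mul_member_nonpos x T q (θ L) L M μ hx0 hx1 (hθ L) hμM hμ1 (hD L (Finset.mem_range.1 hL)) (α L) (β L) (hβ L) (hαβ L)

/-! ### DEC of a gated factor at every layer -/

/-- **SGC's hypotheses on one factor give DEC of `gate μ q` at EVERY layer** (below the top: hypothesis; at or above: Theorem A, the gated
law being top-affordable). [this work] -/
theorem decAt_gate_allLayers (y q : ℝ) (M : ℕ) (μ : ℕ → ℝ) (hy0 : 0 < y) (hy1 : y < 1) (hq0 : 0 ≤ q) (hq1 : q ≤ 1)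
    (hμ0 : ∀ h, 0 ≤ μ h) (hμM : ∀ h, M < h → μ h = 0) (hμ1 : ∑ h ∈ Finset.range (M + 1), μ h = 1)
    (hta : y * (M : ℝ) ≤ q * ∑ h ∈ Finset.range (M + 1), (h : ℝ) * μ h)
    (hD : ∀ L, L < M → DECAt y L M (gate μ q)) (L : ℕ) : DECAt y L M (gate μ q) := by
  by_cases hL : L < M
  · exact hD L hL
  · obtain ⟨hν0, hνM, hν1⟩ := gate_laws M μ q hq0 hq1 hμ0 hμM hμ1
    refine decAt_of_top_le M (gate μ q) hν0 hνM hν1 y hy1 ?_ L (not_lt.1 hL)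
    intro h hh
    have hhM : h ≤ M := not_lt.1 fun hc => (lt_irrefl (0 : ℝ)) (by rw [hνM h hc] at hh; exact hh)
    rw [sum_mul_gate]
    calc y * (h : ℝ) ≤ y * M := mul_le_mul_of_nonneg_left (by exact_mod_cast hhM) hy0.le
      _ ≤ _ := hta

/-! ### Two standard members are valid price systems -/

/-- `usage` is nonnegative on compatible pairs (`0 < x < 1`). [this work] -/
theorem usage_nonneg_of_compat (x T : ℝ) (L l h : ℕ) (hx0 : 0 < x) (hx1 : x < 1) (hlow : 2 * (l : ℝ) < T)
    (hc : L + 1 ≤ h ∨ T < (l : ℝ) + h) (hlL : l ≤ L) : 0 ≤ usage x T L l h := by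
  have hlh : l < h := by
    rcases hc with hc | hc
    · omega
    · have : (l : ℝ) < h := by linarith
      exact_mod_cast this
  simp only [usage, gateOf]
  split_ifs with hg
  · exact div_nonneg hx0.le (by linarith)
  · have hc' : T < (l : ℝ) + h := by
      rcases hc with hc | hc
      · exact absurd hc hg
      · exact hc
    have h0 := pairGate_pos x T l h hlow hlh
    have h1 := pairGate_lt_one x T l h hx0 hx1 hlow hc'
    exact div_nonneg h0.le (by linarith)

/-- **THE TWO-LAYER ROW IS A PRICE SYSTEM** (lead g37's TLB family, dual form).  At `(x, T, L)` charge the lows `l ≤ t` at the giant rate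
`c·x/(1−x)` and price the giants `c ≥ 0`, the mids `0`: valid as soon as the charged lows are incompatible with every mid, i.e.
`t + L ≤ T`.  Its inequality is `x/(1−x)·ν{lows ≤ t} ≤ ν{> L}`. [this work] -/
theorem twoLayer_valid (x T c : ℝ) (L M t : ℕ) (hx0 : 0 < x) (hx1 : x < 1) (hc : 0 ≤ c) (htL : (t : ℝ) + L ≤ T) :
    ∀ l h, l ≤ L → 2 * (l : ℝ) < T → h ≤ M → (L + 1 ≤ h ∨ T < (l : ℝ) + h) →
      (if l ≤ t then x / (1 - x) * c else 0) ≤ usage x T L l h * (if L + 1 ≤ h then c else 0) := by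
  intro l h hlL hlow _ hcomp
  by_cases hg : L + 1 ≤ h
  · rw [if_pos hg, usage_giant_eq x T L l h hg]
    split_ifs with hlt
    · exact le_rfl
    · exact mul_nonneg (div_nonneg hx0.le (by linarith)) hc
  · rw [if_neg hg, mul_zero]
    have hmid : T < (l : ℝ) + h := by
      rcases hcomp with hc' | hc'
      · exact absurd hc' hg
      · exact hc'
    split_ifs with hlt
    · exfalso
      have h1 : (l : ℝ) ≤ t := by exact_mod_cast hlt
      have h2 : (h : ℝ) ≤ L := by exact_mod_cast (by omega : h ≤ L)
      linarith
    · exact le_rfl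

/-- **THE PULLBACK OF A PRODUCT PRICE SYSTEM TO A HIGH ROW IS A PRICE SYSTEM** (arm-2 g37's horizontal transport in dual form).
Product structure `(y, S + Δ, J + s, M₁ + M₂)` with a price system `(α, β)`; row `s` with `1 ≤ s ≤ M₂` and `Δ ≤ 2s` (for SGC: `S = τ₁`,
`Δ = τ₂`, a HIGH row, natural layer `J = j − s`).  Then `l ↦ α(l+s)` on the row's lows whose cell is a product low (`0` elsewhere),
`h ↦ β(h+s)`, is a price system of `(y, S, J, M₁)`: compatibility transports (`h ≥ J+1 ⟹ h+s ≥ J+s+1`; `S < l+h ⟹ S+Δ < (l+s)+(h+s)`)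
and rates only improve (`usage_shift_le` with `Δ = (Δ/s)·s`, `Δ/s ≤ 2`). [this work] -/
theorem pullback_valid (y S Δ : ℝ) (J s M₁ M₂ : ℕ) (α β : ℕ → ℝ) (hy0 : 0 < y) (hy1 : y < 1) (hs : 1 ≤ s) (hsM : s ≤ M₂)
    (hΔs : Δ ≤ 2 * (s : ℝ)) (hβ : ∀ h, 0 ≤ β h)
    (hαβ : ∀ l h, l ≤ J + s → 2 * (l : ℝ) < S + Δ → h ≤ M₁ + M₂ → (J + s + 1 ≤ h ∨ S + Δ < (l : ℝ) + h) →
      α l ≤ usage y (S + Δ) (J + s) l h * β h) :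
    ∀ l h, l ≤ J → 2 * (l : ℝ) < S → h ≤ M₁ → (J + 1 ≤ h ∨ S < (l : ℝ) + h) →
      (if 2 * ((l + s : ℕ) : ℝ) < S + Δ then α (l + s) else 0) ≤ usage y S J l h * β (h + s) := by
  intro l h hlJ hlow hhM hcomp
  have hlh : l < h := by
    rcases hcomp with hc | hc
    · omega
    · have : (l : ℝ) < h := by linarith
      exact_mod_cast this
  split_ifs with hpl
  · have hcomp' : J + s + 1 ≤ h + s ∨ S + Δ < ((l + s : ℕ) : ℝ) + ((h + s : ℕ) : ℝ) := by
      rcases hcomp with hc | hc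
      · exact Or.inl (by omega)
      · refine Or.inr ?_
        push_cast
        linarith
    have h1 := hαβ (l + s) (h + s) (by omega) hpl (by omega) hcomp'
    have hs0 : (0 : ℝ) < s := by exact_mod_cast (show 0 < s by omega)
    have e : S + Δ = S + Δ / s * s := by field_simp
    have h2 : usage y (S + Δ) (J + s) (l + s) (h + s) ≤ usage y S J l h := by
      rw [e]
      exact usage_shift_le y S (Δ / s) J s l h hy0 hy1 (by rw [div_le_iff₀ hs0]; linarith) hlow hlh hcomp
    exact h1.trans (mul_le_mul_of_nonneg_right h2 (hβ _))
  · exact mul_nonneg (usage_nonneg_of_compat y S J l h hy0 hy1 hlow hcomp hlJ) (hβ _)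

end LawDec

end Quant

end Summit.CriticalPhenomena.PercolationContinuityZ3.Theorems
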